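import Summits.CriticalPhenomena.PercolationContinuityZ3.Theorems.SahiMasterFamilyPointwiseFaceVanishing

/-!
# Pointwise (EQ-3) and strict Kahn in EVENT form (`sahiE3 (prodBernoulli p) A B C`), for the classes settled by gen 13

Unit `prim-master-conj` (crux anchor stmt-CriticalPhenomena-4575, helper work), gen 13; quotable event-level corollaries of `SahiMasterFamilyPointwiseStrata.lean`
and `SahiMasterFamilyPointwiseFaceVanishing.lean` in the vocabulary of Kahn's Conjecture 5 (`KahnConjecture`: `0 ≤ sahiE3 (prodBernoulli p) A B C`):
for increasing `A, B, C` and `p` in the open cube,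
* `sahiE3_eq_zero_iff_of_faceVanishing` / `sahiE3_pos_of_faceVanishing` — if every one-coordinate minor `(A^{e←b}, B^{e←b}, C^{e←b})` is a zero flag then
  `E₃(μ_p;A,B,C) = 0 ↔ (A,B,C) ∈ Z₃`, and `E₃(μ_p;A,B,C) > 0` otherwise;
* `sahiE3_eq_zero_iff_of_principalCap` / `sahiE3_pos_of_principalCap` — the same when `A ∩ B ∩ C = {T | c ⊆ T}` is a cylinder;
* `sahiE3_pos_of_pairwiseDependent_faceVanishing` — a PAIRWISE-DEPENDENT face-vanishing triple (no two members determined by disjoint coordinate sets) has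
  `E₃ > 0` at every interior `p`: Kahn's inequality, strictly, on this class.
Nothing is asserted in general; axioms standard. [this work]
-/

noncomputable section

open scoped Classical

namespace Summit.CriticalPhenomena.PercolationContinuityZ3.Theorems

open Finset Function
open Literature.Combinatorics.Sahi2008
open Literature.Probability.LatticeModels (prodBernoulli sahiE3)
open Literature.Probability.Percolation (DeterminedBy)
open Literature.Probability.Percolation.DecisionTree (ind)

namespace Pointwise

variable {ι : Type} [Fintype ι]

omit [Fintype ι] in
/-- The `Fin 3`-family of three events and its basic bookkeeping. [this work] -/
theorem isUpperSet_vec3 {A B C : Set (Set ι)} (hA : IsUpperSet A) (hB : IsUpperSet B) (hC : IsUpperSet C) :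
    ∀ j, IsUpperSet ((![A, B, C] : Fin 3 → Set (Set ι)) j) := by
  intro j; fin_cases j <;> assumption

/-- `E₃` of the `Fin 3`-family is `sahiE3`. [this work] -/
theorem sahiE_vec3_eq_sahiE3 (p : ι → unitInterval) (A B C : Set (Set ι)) :
    sahiE (bernoulliWeight p) 3 (fun j => ind ((![A, B, C] : Fin 3 → Set (Set ι)) j)) = sahiE3 (prodBernoulli p) A B C := by
  have e : (fun j => ind ((![A, B, C] : Fin 3 → Set (Set ι)) j)) = ![ind A, ind B, ind C] := by
    funext j; fin_cases j <;> rfl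
  rw [e, sahiE_three_ind]

/-! ### Face-vanishing triples -/

/-- **Pointwise (EQ-3) for a face-vanishing triple, event form**: if `A, B, C` are increasing, determined by `S`, and all their one-coordinate minors at
coordinates of `S` are zero flags, then for `p` in the open cube `E₃(μ_p; A, B, C) = 0 ↔ (A, B, C) ∈ Z₃`. [this work] -/
theorem sahiE3_eq_zero_iff_of_faceVanishing (p : ι → unitInterval) (hp : ∀ e, (p e : ℝ) ∈ Set.Ioo (0 : ℝ) 1) {A B C : Set (Set ι)}
    (hA : IsUpperSet A) (hB : IsUpperSet B) (hC : IsUpperSet C) (S : Finset ι) (hAS : DeterminedBy A (↑S : Set ι))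
    (hBS : DeterminedBy B (↑S : Set ι)) (hCS : DeterminedBy C (↑S : Set ι))
    (hfv : ∀ e ∈ S, ∀ b : Bool, SuppZeroFlag 3 ![secAt e b A, secAt e b B, secAt e b C]) :
    sahiE3 (prodBernoulli p) A B C = 0 ↔ SuppZeroFlag 3 ![A, B, C] := by
  rw [← sahiE_vec3_eq_sahiE3]
  refine sahiE_three_ind_eq_zero_iff_of_faceVanishing ι p hp _ S (isUpperSet_vec3 hA hB hC) (fun j => ?_) (fun e he b => ?_)
  · fin_cases j <;> assumption
  · have efam : (fun j => secAt e b ((![A, B, C] : Fin 3 → Set (Set ι)) j)) = ![secAt e b A, secAt e b B, secAt e b C] := by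
      funext j; fin_cases j <;> rfl
    rw [efam]; exact hfv e he b

/-- **Strict Kahn on face-vanishing triples, event form**: off `Z₃`, `E₃(μ_p; A, B, C) > 0` at every interior `p`. [this work] -/
theorem sahiE3_pos_of_faceVanishing (p : ι → unitInterval) (hp : ∀ e, (p e : ℝ) ∈ Set.Ioo (0 : ℝ) 1) {A B C : Set (Set ι)}
    (hA : IsUpperSet A) (hB : IsUpperSet B) (hC : IsUpperSet C) (S : Finset ι) (hAS : DeterminedBy A (↑S : Set ι))
    (hBS : DeterminedBy B (↑S : Set ι)) (hCS : DeterminedBy C (↑S : Set ι))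
    (hfv : ∀ e ∈ S, ∀ b : Bool, SuppZeroFlag 3 ![secAt e b A, secAt e b B, secAt e b C]) (hZ : ¬ SuppZeroFlag 3 ![A, B, C]) :
    0 < sahiE3 (prodBernoulli p) A B C := by
  rw [← sahiE_vec3_eq_sahiE3]
  refine sahiE_three_ind_pos_of_faceVanishing ι p hp _ S (isUpperSet_vec3 hA hB hC) (fun j => ?_) (fun e he b => ?_) hZ
  · fin_cases j <;> assumption
  · have efam : (fun j => secAt e b ((![A, B, C] : Fin 3 → Set (Set ι)) j)) = ![secAt e b A, secAt e b B, secAt e b C] := by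
      funext j; fin_cases j <;> rfl
    rw [efam]; exact hfv e he b

/-- **Kahn's inequality is STRICT on pairwise-dependent face-vanishing triples**: if moreover no two of `A, B, C` are determined by disjoint coordinate sets,
then `E₃(μ_p; A, B, C) > 0` at every interior `p`. [this work] -/
theorem sahiE3_pos_of_pairwiseDependent_faceVanishing (p : ι → unitInterval) (hp : ∀ e, (p e : ℝ) ∈ Set.Ioo (0 : ℝ) 1) {A B C : Set (Set ι)}
    (hA : IsUpperSet A) (hB : IsUpperSet B) (hC : IsUpperSet C) (S : Finset ι) (hAS : DeterminedBy A (↑S : Set ι))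
    (hBS : DeterminedBy B (↑S : Set ι)) (hCS : DeterminedBy C (↑S : Set ι))
    (hfv : ∀ e ∈ S, ∀ b : Bool, SuppZeroFlag 3 ![secAt e b A, secAt e b B, secAt e b C])
    (hdep : ∀ m : Fin 3, ¬ SuppZeroFlag 2 (fun j => (![A, B, C] : Fin 3 → Set (Set ι)) (m.succAbove j))) :
    0 < sahiE3 (prodBernoulli p) A B C :=
  sahiE3_pos_of_faceVanishing p hp hA hB hC S hAS hBS hCS hfv fun hZ => by
    obtain ⟨m, hm, -⟩ := hZ
    exact hdep m hm

/-! ### Principal cap -/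

/-- **Pointwise (EQ-3) on the principal-cap stratum, event form.** [this work] -/
theorem sahiE3_eq_zero_iff_of_principalCap (p : ι → unitInterval) (hp : ∀ e, (p e : ℝ) ∈ Set.Ioo (0 : ℝ) 1) {A B C : Set (Set ι)}
    (hA : IsUpperSet A) (hB : IsUpperSet B) (hC : IsUpperSet C) (c : Finset ι)
    (hpc : ∀ T : Set ι, (T ∈ A ∧ T ∈ B ∧ T ∈ C) ↔ (↑c : Set ι) ⊆ T) :
    sahiE3 (prodBernoulli p) A B C = 0 ↔ SuppZeroFlag 3 ![A, B, C] := by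
  rw [← sahiE_vec3_eq_sahiE3]
  refine sahiE_three_ind_eq_zero_iff_of_principalCap p hp _ (isUpperSet_vec3 hA hB hC) c fun T => ?_
  rw [← hpc T]
  constructor
  · intro h; exact ⟨h 0, h 1, h 2⟩
  · rintro ⟨h0, h1, h2⟩ j
    fin_cases j
    · exact h0
    · exact h1
    · exact h2

/-- **Strict Kahn on the principal-cap stratum, event form.** [this work] -/
theorem sahiE3_pos_of_principalCap (p : ι → unitInterval) (hp : ∀ e, (p e : ℝ) ∈ Set.Ioo (0 : ℝ) 1) {A B C : Set (Set ι)}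
    (hA : IsUpperSet A) (hB : IsUpperSet B) (hC : IsUpperSet C) (c : Finset ι)
    (hpc : ∀ T : Set ι, (T ∈ A ∧ T ∈ B ∧ T ∈ C) ↔ (↑c : Set ι) ⊆ T) (hZ : ¬ SuppZeroFlag 3 ![A, B, C]) :
    0 < sahiE3 (prodBernoulli p) A B C := by
  rw [← sahiE_vec3_eq_sahiE3]
  refine sahiE_three_ind_pos_of_principalCap p hp _ (isUpperSet_vec3 hA hB hC) c (fun T => ?_) hZ
  rw [← hpc T]
  constructor
  · intro h; exact ⟨h 0, h 1, h 2⟩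
  · rintro ⟨h0, h1, h2⟩ j
    fin_cases j
    · exact h0
    · exact h1
    · exact h2

end Pointwise

end Summit.CriticalPhenomena.PercolationContinuityZ3.Theorems
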